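import Literature.MathematicalPhysics.QuantumFieldTheory.YangMillsOS
import Literature.MathematicalPhysics.QuantumFieldTheory.SpeciesTimeReflection
import HarnessLib

/-!
# `CrossoverDecay` — DEBT CERTIFICATE: `PinnedTwoLetters → CrossoverDecay`, PROVED (typing AND proofs: ideator ym-idea-3 g26, §8 of HOME
# `g26/crossover-vs-ir.lean` rev 3 `6dcf3577daabfc8c`, critic idea-crit-4 PASS by hash 2026-08-30T01:43:20Z; landed verbatim by the free-hands seat
# ym-line-frs-p2 g20 at g26's request 01:53:09Z, `--supports stmt-QuantumFields-23763 --as helper`)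

THIS FILE PROVES ONLY THE REDUCTION `crossoverDecay_of_pinnedTwoLetters : PinnedTwoLetters → CrossoverDecay` (with its parts
`crossoverDecayPinned₀_of_hyperscaled₀`, `hdecay_of_pinned`, `crossoverDecay_of_pinned`, `crossoverDecay_of_hyperscaled_and_window`).
`PinnedTwoLetters` = ∃ (b → 0⁺), `HyperscaledClustering₀ r b` ∧ `AxisUVWindow r b` are OPEN DEBTS — the infrared clustering of both mirror orders of the
curvature pair WITH the hyperscaling constant (`|lcc(n)| ≤ C n⁻⁸ e^{−c₁ b(β) n}` on every torus) and the asymptotic-freedom WINDOW in the same units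
(`Gs ≤ η` below physical scale `κ(η)`); neither is proved anywhere, neither follows from the ladder letters `IR`/`IRcof` as typed (g26's report
`g26/crossover-vs-ir.md`).  `CrossoverDecay` (the registered stub `stub_crossoverDecay` of `Cruxes/SubCurvatureClause/Lines/rp_moebius_ladder.lean`)
stays OPEN — its content is now BY NAME `PinnedTwoLetters` (census label, REDUCTION-CENSUS v6.170 §J.2: a THIRD IR-end letter, neither ⇒ nor ⇐
`BalabanLadder.IR` as typed; landed on director-ym «GO (c)» 2026-08-30T02:18:30Z).  The UV twin is ✓`…MoebiusRowDebts.moebiusRow_of_debts : CompositeAFDebts → MoebiusRow`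
(`Theorems/F4SubCurvatureDoorSubCurvatureClauseMoebiusRowOfDebts.lean`).  Every `def` body below is byte-identical to g26's file; the axis letters
`axisG/axisG'/axisGs` and `CrossoverDecay` are byte-identical to the registered Lines file `995e59ee23adafad` :66–:85, :107.

MECHANISM (g26): at a crossing `η < Gs(s₀)` the window forces `κ ≤ b·s₀` (contrapositive); the hyperscaled bound gives
`Gs(s) ≤ 2⁸C·e^{−2c₁ b s} ≤ 2⁸C·e^{−2c₁κM} ≤ ε` for `s ≥ M s₀`, uniformly in `β` and in the volume.

HONEST LABEL: a reduction between OPEN letters; `HyperscaledClustering₀`, `AxisUVWindow`, `CrossoverDecay`, `MoebiusRow`, `IR`, ⟨23763⟩, ⟨24275⟩,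
⟨26930⟩ OPEN; the Yang–Mills mass gap is NOT proved; no summit is proved by a line.
-/

set_option autoImplicit false

noncomputable section

open MeasureTheory Filter Topology
open Literature.MathematicalPhysics.QuantumFieldTheory Literature.MathematicalPhysics.QuantumLattice

namespace Summit.QuantumFields.YangMills.Cruxes.SubCurvatureClause.CrossoverVsIR

/-! ## §1 The axis letters (VERBATIM def bodies of the registered line `Lines/rp_moebius_ladder.lean` :66–:85) -/

section Objects

variable {G : Type} [Group G] [TopologicalSpace G] [IsTopologicalGroup G] [CompactSpace G]
  [MeasurableSpace G] [BorelSpace G]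

/-- `G(β, L, t) := (2t)⁸ · lCC_{β,2L+1}(Q^θ, Q, 2t)` (verbatim). -/
def axisG (r : LatticeRep G) (β : ℝ) (L t : ℕ) : ℝ :=
  ((2 * t : ℕ) : ℝ) ^ 8 *
    latticeConnectedCorr r.ρ β (2 * L + 1) r.curvature.timeReflect.F r.curvature.F (2 * t)

/-- The mirror order `G'(β, L, t) := (2t)⁸ · lCC_{β,2L+1}(Q, Q^θ, 2t)` (verbatim). -/
def axisG' (r : LatticeRep G) (β : ℝ) (L t : ℕ) : ℝ :=
  ((2 * t : ℕ) : ℝ) ^ 8 *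
    latticeConnectedCorr r.ρ β (2 * L + 1) r.curvature.F r.curvature.timeReflect.F (2 * t)

/-- `Gs := max G G'` (verbatim). -/
def axisGs (r : LatticeRep G) (β : ℝ) (L t : ℕ) : ℝ :=
  max (axisG r β L t) (axisG' r β L t)

/-- Shorthand: the `(Q^θ, Q)` mirror correlator at lag `n`. -/
def lcc (r : LatticeRep G) (β : ℝ) (L n : ℕ) : ℝ :=
  latticeConnectedCorr r.ρ β (2 * L + 1) r.curvature.timeReflect.F r.curvature.F n

/-- Shorthand: the `(Q, Q^θ)` mirror correlator at lag `n`. -/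
def lcc' (r : LatticeRep G) (β : ℝ) (L n : ℕ) : ℝ :=
  latticeConnectedCorr r.ρ β (2 * L + 1) r.curvature.F r.curvature.timeReflect.F n

/-- `axisG = (2t)⁸ · lcc (2t)`. [bookkeeping] -/
theorem axisG_eq (r : LatticeRep G) (β : ℝ) (L t : ℕ) : axisG r β L t = ((2 * t : ℕ) : ℝ) ^ 8 * lcc r β L (2 * t) := rfl

/-- `axisG' = (2t)⁸ · lcc' (2t)`. [bookkeeping] -/
theorem axisG'_eq (r : LatticeRep G) (β : ℝ) (L t : ℕ) : axisG' r β L t = ((2 * t : ℕ) : ℝ) ^ 8 * lcc' r β L (2 * t) := rfl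

end Objects

/-- **The registered letter `CrossoverDecay`** (VERBATIM body of `Lines/rp_moebius_ladder.lean` :107 — the OPEN stub `stub_crossoverDecay`; an
open statement, not a Literature fact). -/
def CrossoverDecay : Prop :=
  ∀ (G : Type) [Group G] [TopologicalSpace G] [IsTopologicalGroup G] [CompactSpace G],
    IsCompactSimpleLieGroup G →
    letI : MeasurableSpace G := borel G
    haveI : BorelSpace G := ⟨rfl⟩
    ∀ (r : LatticeRep G) (η : ℝ), 0 < η → ∀ ε : ℝ, 0 < ε →
      ∃ (M : ℕ) (β₁ : ℝ), ∀ β : ℝ, β₁ ≤ β → ∀ (L s₀ s : ℕ), 1 ≤ s₀ → η < axisGs r β L s₀ →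
        M * s₀ ≤ s → 4 * s + 8 ≤ L → axisGs r β L s ≤ ε

/-! ## §2 The two letters and the bridge (§8 of g26's `crossover-vs-ir.lean` rev 3, verbatim) -/

section Bridge

variable {G : Type} [Group G] [TopologicalSpace G] [IsTopologicalGroup G] [CompactSpace G]
  [MeasurableSpace G] [BorelSpace G]

/-- **`AxisUVWindow G r b`** (ultraviolet letter, asymptotic-freedom side): for every level `η > 0` there is a physical scale `κ(η) > 0` in
units `b` below which the axis coupling stays `≤ η`, for all large `β` and every torus fitting the scale. -/
def AxisUVWindow (r : LatticeRep G) (b : ℝ → ℝ) : Prop :=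
  ∀ η : ℝ, 0 < η → ∃ κ βu : ℝ, 0 < κ ∧ ∀ β : ℝ, βu ≤ β → ∀ L s : ℕ, 1 ≤ s → 4 * s + 8 ≤ L →
    b β * s < κ → axisGs r β L s ≤ η

/-- **`HyperscaledClustering₀ G r b`** — `HyperscaledClustering` on EVERY torus (no volume threshold: on tori smaller than the correlation
length the exponential is `≍ 1` and the letter is plain hyperscaling `|lcc(n)| ≤ C n⁻⁸`). -/
def HyperscaledClustering₀ (r : LatticeRep G) (b : ℝ → ℝ) : Prop :=
  ∃ (c₁ C β₂ : ℝ), 0 < c₁ ∧ 0 < C ∧ ∀ β : ℝ, β₂ ≤ β → ∀ L n : ℕ, 1 ≤ n → n ≤ L →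
    |lcc r β L n| ≤ C / (n : ℝ) ^ 8 * Real.exp (-(c₁ * b β * n)) ∧
    |lcc' r β L n| ≤ C / (n : ℝ) ^ 8 * Real.exp (-(c₁ * b β * n))

/-- **`CrossoverDecayPinned₀ G r b`** — `CrossoverDecay`'s body with the crossing premise `η < Gs(s₀)` replaced by the pin `κ ≤ b β·s₀`
(no volume threshold). -/
def CrossoverDecayPinned₀ (r : LatticeRep G) (b : ℝ → ℝ) : Prop :=
  ∀ ε κ : ℝ, 0 < ε → 0 < κ →
    ∃ (M : ℕ) (β₁ : ℝ), ∀ β : ℝ, β₁ ≤ β → ∀ (L s₀ s : ℕ),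
      1 ≤ s₀ → κ ≤ b β * s₀ → M * s₀ ≤ s → 4 * s + 8 ≤ L → axisGs r β L s ≤ ε

/-- Hyperscaled clustering on every torus ⇒ pinned decay on every torus (proved; the arithmetic of `crossoverDecayPinned_of_hyperscaled`). -/
theorem crossoverDecayPinned₀_of_hyperscaled₀ (r : LatticeRep G) (b : ℝ → ℝ) (hb : ∀ β, 0 < b β)
    (h : HyperscaledClustering₀ r b) : CrossoverDecayPinned₀ r b := by
  intro ε κ hε hκ
  obtain ⟨c₁, C, β₂, hc₁, hC, hclu⟩ := h
  have hlim : Tendsto (fun x : ℝ => 2 ^ 8 * C * Real.exp (-x)) atTop (nhds 0) := by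
    simpa using (Real.tendsto_exp_neg_atTop_nhds_zero).const_mul (2 ^ 8 * C)
  obtain ⟨X₀, hX₀⟩ := eventually_atTop.1 (hlim.eventually (gt_mem_nhds hε))
  set M : ℕ := ⌈max (X₀ / (2 * c₁ * κ)) 1⌉₊ with hM
  have hMge : max (X₀ / (2 * c₁ * κ)) 1 ≤ (M : ℝ) := Nat.le_ceil _
  have hM1r : (1 : ℝ) ≤ M := (le_max_right _ _).trans hMge
  have hM1 : 1 ≤ M := by exact_mod_cast hM1r
  have hMX : X₀ / (2 * c₁ * κ) ≤ (M : ℝ) := (le_max_left _ _).trans hMge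
  refine ⟨M, β₂, fun β hβ L s₀ s hs₀ hκs hMs hsL => ?_⟩
  have hs1 : 1 ≤ s := le_trans (le_trans hs₀ (by simpa using Nat.mul_le_mul_right s₀ hM1)) hMs
  have h2s : 2 * s ≤ L := by omega
  obtain ⟨h1, h2⟩ := hclu β hβ L (2 * s) (by omega) h2s
  have hb0 := hb β
  have hexp : X₀ ≤ c₁ * b β * ((2 * s : ℕ) : ℝ) := by
    have hsr : (M : ℝ) * s₀ ≤ s := by exact_mod_cast hMs
    have h3 : X₀ ≤ 2 * c₁ * κ * M := by
      have := (div_le_iff₀ (by positivity : (0 : ℝ) < 2 * c₁ * κ)).1 hMX; linarith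
    have h4 : κ * (M : ℝ) ≤ b β * s := by
      calc κ * (M : ℝ) ≤ b β * s₀ * M := mul_le_mul_of_nonneg_right hκs (Nat.cast_nonneg M)
        _ = b β * ((M : ℝ) * s₀) := by ring
        _ ≤ b β * s := mul_le_mul_of_nonneg_left hsr hb0.le
    push_cast
    nlinarith [h3, h4, hc₁]
  have hbound : 2 ^ 8 * C * Real.exp (-(c₁ * b β * ((2 * s : ℕ) : ℝ))) ≤ ε := by
    have := (hX₀ (c₁ * b β * ((2 * s : ℕ) : ℝ)) hexp).le
    simpa using this
  have h2sr : (0 : ℝ) < ((2 * s : ℕ) : ℝ) := by exact_mod_cast (show 0 < 2 * s by omega)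
  have hP : (0 : ℝ) < ((2 * s : ℕ) : ℝ) ^ 8 := by positivity
  have hkey : ∀ c : ℝ, |c| ≤ C / ((2 * s : ℕ) : ℝ) ^ 8 * Real.exp (-(c₁ * b β * ((2 * s : ℕ) : ℝ))) →
      ((2 * s : ℕ) : ℝ) ^ 8 * c ≤ ε := by
    intro c hc
    have hc' := (le_abs_self c).trans hc
    calc ((2 * s : ℕ) : ℝ) ^ 8 * c
        ≤ ((2 * s : ℕ) : ℝ) ^ 8 * (C / ((2 * s : ℕ) : ℝ) ^ 8 * Real.exp (-(c₁ * b β * ((2 * s : ℕ) : ℝ)))) :=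
          mul_le_mul_of_nonneg_left hc' hP.le
      _ = C * Real.exp (-(c₁ * b β * ((2 * s : ℕ) : ℝ))) := by field_simp
      _ ≤ 2 ^ 8 * C * Real.exp (-(c₁ * b β * ((2 * s : ℕ) : ℝ))) := by
          have : 0 ≤ C * Real.exp (-(c₁ * b β * ((2 * s : ℕ) : ℝ))) := by positivity
          nlinarith [this]
      _ ≤ ε := hbound
  refine max_le ?_ ?_
  · rw [axisG_eq]; exact hkey _ (by exact_mod_cast h1)
  · rw [axisG'_eq]; exact hkey _ (by exact_mod_cast h2)

end Bridge

/-- **ABSTRACT BRIDGE (proved) — the drop-in for the registered composition's `hdecay'`** (`Lines/rp_moebius_ladder.lean` :510 ∕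
`profile_window`'s `hdecay`): along any sequence of lattices, an ultraviolet window in auxiliary units `b_k` plus pinned decay in the same
units give decay past every CROSSING, with the same `β`-uniform `M`. -/
theorem hdecay_of_pinned {N : ℕ → ℕ} {g : ℕ → ℕ → ℝ} {b : ℕ → ℝ} {η κ : ℝ}
    (hpin : ∀ᶠ k in atTop, ∀ s : ℕ, 1 ≤ s → 4 * s + 8 ≤ N k → b k * s < κ → g k s ≤ η)
    (hdec : ∀ ε : ℝ, 0 < ε → ∃ M : ℕ, ∀ᶠ k in atTop, ∀ s₀ s : ℕ, 1 ≤ s₀ → κ ≤ b k * s₀ → M * s₀ ≤ s →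
      4 * s + 8 ≤ N k → g k s ≤ ε) :
    ∀ ε : ℝ, 0 < ε → ∃ M : ℕ, ∀ᶠ k in atTop, ∀ s₀ s : ℕ, 1 ≤ s₀ → η < g k s₀ → M * s₀ ≤ s →
      4 * s + 8 ≤ N k → g k s ≤ ε := by
  intro ε hε
  obtain ⟨M, hM⟩ := hdec ε hε
  refine ⟨max M 1, ?_⟩
  filter_upwards [hpin, hM] with k hpk hMk s₀ s hs₀ hcross hMs hsN
  have hs₀s : s₀ ≤ s := le_trans (by simpa using Nat.mul_le_mul_right s₀ (le_max_right M 1)) hMs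
  have hκ : κ ≤ b k * s₀ := by
    by_contra hlt
    exact absurd (hpk s₀ hs₀ (by omega) (lt_of_not_ge hlt)) (not_le.2 hcross)
  exact hMk s₀ s hs₀ hκ (le_trans (Nat.mul_le_mul_right s₀ (le_max_left M 1)) hMs) hsN

/-- **THE BRIDGE INTO `CrossoverDecay` AS TYPED (proved):** pinned decay + ultraviolet window in SOME common units, for every `(G, r)`, imply
the registered letter's body verbatim (here the vendored `CrossoverDecay`; by name against `RpMoebiusLadder.CrossoverDecay` the same term
closes `stub_crossoverDecay` once that module is importable — bodies are byte-identical). -/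
theorem crossoverDecay_of_pinned
    (h : ∀ (G : Type) [Group G] [TopologicalSpace G] [IsTopologicalGroup G] [CompactSpace G],
      IsCompactSimpleLieGroup G →
      letI : MeasurableSpace G := borel G
      haveI : BorelSpace G := ⟨rfl⟩
      ∀ (r : LatticeRep G), ∃ b : ℝ → ℝ, CrossoverDecayPinned₀ r b ∧ AxisUVWindow r b) :
    CrossoverDecay := by
  intro G _ _ _ _ hG
  letI : MeasurableSpace G := borel G
  haveI : BorelSpace G := ⟨rfl⟩
  intro r η hη ε hε
  obtain ⟨b, hdec, hwin⟩ := h G hG r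
  obtain ⟨κ, βu, hκ, hwin⟩ := hwin η hη
  obtain ⟨M, β₁, hM⟩ := hdec ε κ hε hκ
  refine ⟨max M 1, max β₁ βu, fun β hβ L s₀ s hs₀ hcross hMs hsL => ?_⟩
  have hs₀s : s₀ ≤ s := le_trans (by simpa using Nat.mul_le_mul_right s₀ (le_max_right M 1)) hMs
  have hκs : κ ≤ b β * s₀ := by
    by_contra hlt
    exact absurd (hwin β ((le_max_right _ _).trans hβ) L s₀ hs₀ (by omega) (lt_of_not_ge hlt)) (not_le.2 hcross)
  exact hM β ((le_max_left _ _).trans hβ) L s₀ s hs₀ hκs (le_trans (Nat.mul_le_mul_right s₀ (le_max_left M 1)) hMs) hsL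

/-- **Corollary (proved): hyperscaled clustering on every torus + ultraviolet window, in some common units with `b > 0`, ⇒ `CrossoverDecay`.**
These are the two NAMED letters (infrared-with-hyperscaling-constant; asymptotic-freedom window) that would discharge the door's IR wall. -/
theorem crossoverDecay_of_hyperscaled_and_window
    (h : ∀ (G : Type) [Group G] [TopologicalSpace G] [IsTopologicalGroup G] [CompactSpace G],
      IsCompactSimpleLieGroup G →
      letI : MeasurableSpace G := borel G
      haveI : BorelSpace G := ⟨rfl⟩
      ∀ (r : LatticeRep G), ∃ b : ℝ → ℝ, (∀ β, 0 < b β) ∧ HyperscaledClustering₀ r b ∧ AxisUVWindow r b) :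
    CrossoverDecay := by
  refine crossoverDecay_of_pinned fun G _ _ _ _ hG => ?_
  letI : MeasurableSpace G := borel G
  haveI : BorelSpace G := ⟨rfl⟩
  intro r
  obtain ⟨b, hb, hH, hW⟩ := h G hG r
  exact ⟨b, crossoverDecayPinned₀_of_hyperscaled₀ r b hb hH, hW⟩

/-- **Pinned form (idea-crit-4 R1, 01:27:30Z): the window letter is vacuous for unit maps bounded below** (`b ≡ 1`: `κ := 1` and the premise
`1·s < 1` never holds), so the located content of `AxisUVWindow` lives in the regime `b(β) → 0`.  The intended hypothesis therefore PINS `b`: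
positive AND tending to `0` (the ladder's floor-carrying units); the bridge is untouched by the extra conjunct. -/
def PinnedTwoLetters : Prop :=
  ∀ (G : Type) [Group G] [TopologicalSpace G] [IsTopologicalGroup G] [CompactSpace G],
    IsCompactSimpleLieGroup G →
    letI : MeasurableSpace G := borel G
    haveI : BorelSpace G := ⟨rfl⟩
    ∀ (r : LatticeRep G), ∃ b : ℝ → ℝ, (∀ β, 0 < b β) ∧ Tendsto b atTop (nhds 0) ∧
      HyperscaledClustering₀ r b ∧ AxisUVWindow r b

/-- **`PinnedTwoLetters → CrossoverDecay`** (proved): the filing shape of the two stubs asked for by the card `ir-wall-two-letters`. -/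
theorem crossoverDecay_of_pinnedTwoLetters (h : PinnedTwoLetters) : CrossoverDecay := by
  refine crossoverDecay_of_hyperscaled_and_window fun G _ _ _ _ hG => ?_
  letI : MeasurableSpace G := borel G
  haveI : BorelSpace G := ⟨rfl⟩
  intro r
  obtain ⟨b, hb, -, hH, hW⟩ := h G hG r
  exact ⟨b, hb, hH, hW⟩

end Summit.QuantumFields.YangMills.Cruxes.SubCurvatureClause.CrossoverVsIR

end
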